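import Literature.Analysis.FunctionSpaces.PoissonMeckePrelims
import Literature.Analysis.FunctionSpaces.PoissonMeckeCylinders
import HarnessLib

/-!
# The multivariate Mecke equation from Kingman's axioms
(trunk T-KINETIC; topic Analysis/FunctionSpaces, next to `PoissonMecke`; DISCHARGES the named fact
`Literature.Analysis.FunctionSpaces.IsPoissonPointProcess.multivariateMecke` — Last–Penrose,
*Lectures on the Poisson Process* (2017), Thm 4.4 — as `IsPoissonPointProcess.multivariateMecke_holds`;
this was the last undischarged input of
`Literature.MathematicalPhysics.KineticTheory.gallavotti_spohn_lorentz`)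

Setting: `E` second countable Hausdorff Borel, `ν` σ-finite, `P` a law on locally finite simple
configurations satisfying Kingman's axioms (`IsPoissonPointProcess ν P`: Poisson counts on sets of
finite intensity, independence over disjoint sets). The proof, using the groundwork of
`PoissonMeckePrelims` and `PoissonMeckeCylinders`:

1. **The generator identity** (`setLIntegral_count_eq_setLIntegral_measure_insert`): for a count
   cylinder `A = {∀ j, N(s j) = k j}` and `B` of finite intensity,
   `𝔼[1_A · N(B)] = ∫_B P(c ∪ {a} ∈ A) ν(da)`. Refine `B, s₀, …, s_{r-1}` into their atoms `T w`
   (inside the union `U`, so that all have finite intensity); the atom counts are independent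
   Poisson variables (Kingman's axioms), `N(B)` and the `N(s j)` are sums of atom counts, and for
   `a ∈ T w` not a point of `c` (a.s.) inserting `a` raises exactly the count of `T w` by one. Both
   sides then equal `∑_{w : w selects B} ν(T w) P(N + e_w ∈ 𝒜)` by the identity
   `𝔼[N_w G(N)] = ν(T w) 𝔼[G(N + e_w)]` (`lintegral_mul_eq_of_iIndepFun_poisson`).
2. **Campbell measure = insertion measure** (`compProd_eq_map_insert`): with `κ` the s-finite
   counting kernel (`κ c = ∑_{a ∈ c} δ_a` a.s.), the measures `P ⊗ₘ κ` and
   `(ν ⊗ P) ∘ ((a, c) ↦ (c ∪ {a}, a))⁻¹` on `PointConfig E × E` agree on the π-system of products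
   of count cylinders with sets of finite intensity, which generates the product σ-algebra and
   carries the exhaustion `univ × S_n` of finite Campbell mass `𝔼 N(S_n) = ν(S_n)`; hence they are
   equal (`Measure.ext_of_generateFrom_of_iUnion`).
3. **The (univariate) Mecke equation** (`lintegral_tsum_eq_lintegral_lintegral_insert`,
   Last–Penrose Thm 4.1, (4.2)): `𝔼 ∑_{a ∈ c} f(c, a) = ∫ 𝔼 f(c ∪ {a}, a) ν(da)` for measurable
   `f ≥ 0`, by integrating against the two equal measures (`Measure.lintegral_compProd`, Tonelli).
4. **The multivariate equation by induction on `m`** (`lintegral_tsum_injective_eq`, Last–Penrose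
   Thm 4.4, proof of (4.11) by induction): a sum over injective `(m+1)`-tuples of points of `c` is a
   sum over the first point `b ∈ c` of sums over injective `m`-tuples avoiding `b`
   (`tsum_injective_succ`); the inner sums have measurable versions in `(b, c)` (a.s., via the
   counting kernel: `exists_measurable_tsum_injective`), so the univariate equation applies; after
   inserting `b ∉ c` (a.s., `measure_setOf_mem_eq_zero`) the constraint "avoiding `b`" is void
   (`tsum_injective_union_single`); the induction hypothesis for `(y, c) ↦ h(b :: y, c ∪ {b})` and
   `c ∪ {b :: y} = (c ∪ {y}) ∪ {b}` give a triple integral, which is the integral over `ν^{⊗(m+1)}`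
   (`lintegral_pi_succ_eq_lintegral_lintegral_cons`).

No new definitions; every sum over points is controlled only almost surely (configurations are
countable on the spanning sets of `ν`), which is all the integrals see.

## References

* G. Last, M. Penrose, *Lectures on the Poisson Process*, Cambridge Univ. Press (2017), Thm 4.1
  (Mecke equation, (4.2)), Thm 4.4 (multivariate Mecke equation, (4.11)).
* J. F. C. Kingman, *Poisson Processes*, Oxford (1993), §2.1.
-/

open MeasureTheory ProbabilityTheory Filter Set TopologicalSpace
open scoped ENNReal NNReal Topology

namespace Literature.Analysis.FunctionSpaces

universe u

namespace IsPoissonPointProcess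

/-- The coercion `ℕ∞ → ℝ≥0∞` is additive over finite sums. [folklore] -/
theorem toENNReal_finset_sum {ι : Type*} (s : Finset ι) (f : ι → ℕ∞) :
    ((∑ i ∈ s, f i : ℕ∞) : ℝ≥0∞) = ∑ i ∈ s, ((f i : ℕ∞) : ℝ≥0∞) := by
  classical
  induction s using Finset.induction_on with
  | empty => simp
  | insert a s ha ih => rw [Finset.sum_insert ha, Finset.sum_insert ha, ENat.toENNReal_add, ih]

variable {E : Type u} [TopologicalSpace E] [T2Space E] [SecondCountableTopology E] [MeasurableSpace E]
  [BorelSpace E] {ν : Measure E} {P : Measure (PointConfig E)}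

/-! ## The two measures agree on the generating π-system -/

/-- **The generator identity of the Mecke equation.** For a Poisson process with σ-finite intensity,
a count cylinder `A = {c | ∀ j, N_c(s j) = k j}` (`s j` measurable of finite intensity) and a
measurable `B` of finite intensity,
`∫_A N(B) dP = ∫_B P{c | c ∪ {a} ∈ A} ν(da)`.
Proof: refine `B, s₀, …` into atoms `T w` of finite intensity (inside their union), whose counts are
independent Poisson (Kingman's axioms); `N(B)` and `N(s j)` are sums of atom counts
(`count_eq_sum_count_atom`); inserting `a ∈ T w`, `a ∉ c` (a.s., `measure_setOf_mem_eq_zero`)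
raises the count of `T w` by one and no other; conclude with
`lintegral_mul_eq_of_iIndepFun_poisson`. (Last–Penrose 2017, proof of Thm 4.1 for indicator
functions; Kingman 1993 §2.1.) [cite: LastPenrose2017, Thm 4.1] -/
theorem setLIntegral_count_eq_setLIntegral_measure_insert [SigmaFinite ν] (h : IsPoissonPointProcess ν P)
    {r : ℕ} {s : Fin r → Set E} (hs : ∀ j, MeasurableSet (s j) ∧ ν (s j) ≠ ∞) (k : Fin r → ℕ)
    {B : Set E} (hB : MeasurableSet B) (hBfin : ν B ≠ ∞) :
    ∫⁻ c in {c : PointConfig E | ∀ j, c.count (s j) = (k j : ℕ∞)}, ((c.count B : ℕ∞) : ℝ≥0∞) ∂P =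
      ∫⁻ a in B, P {c : PointConfig E |
        ∀ j, (c ∪ PointConfig.ofFn (fun _ : Fin 1 => a)).count (s j) = (k j : ℕ∞)} ∂ν := by
  classical
  haveI := h.isProbabilityMeasure
  -- the family `t = (B, s₀, …)`, its union `U`, and the atoms `T w`
  set t : Fin (r + 1) → Set E := Fin.cons B s with ht
  have ht0 : t 0 = B := by simp [ht]
  have htsucc : ∀ i : Fin r, t i.succ = s i := fun i => by simp [ht]
  have htm : ∀ j, MeasurableSet (t j) := fun j => by
    refine Fin.cases ?_ (fun i => ?_) j
    · rw [ht0]; exact hB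
    · rw [htsucc]; exact (hs i).1
  have htfin : ∀ j, ν (t j) ≠ ∞ := fun j => by
    refine Fin.cases ?_ (fun i => ?_) j
    · rw [ht0]; exact hBfin
    · rw [htsucc]; exact (hs i).2
  set U : Set E := ⋃ j, t j with hU
  have hUm : MeasurableSet U := MeasurableSet.iUnion htm
  have hUfin : ν U ≠ ∞ := by
    refine ne_top_of_le_ne_top ?_ (measure_iUnion_le t)
    rw [tsum_fintype]
    exact ENNReal.sum_ne_top.2 fun j _ => htfin j
  set T : (Fin (r + 1) → Bool) → Set E := fun w => U ∩ ⋂ j, bif w j then t j else (t j)ᶜ with hT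
  have hTm : ∀ w, MeasurableSet (T w) := fun w => hUm.inter (PointConfig.measurableSet_atom t htm w)
  have hTfin : ∀ w, ν (T w) ≠ ∞ := fun w => ne_top_of_le_ne_top hUfin (measure_mono inter_subset_left)
  have hTdisj : Pairwise (Function.onFun Disjoint T) := fun w w' hww' =>
    (PointConfig.disjoint_atom t hww').mono inter_subset_right inter_subset_right
  have hTeq : ∀ {w : Fin (r + 1) → Bool} {j : Fin (r + 1)}, w j = true →
      T w = ⋂ i, bif w i then t i else (t i)ᶜ := fun {w j} hj =>
    inter_eq_right.2 ((PointConfig.atom_subset t hj).trans (subset_iUnion t j))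
  -- every count of `t j` is the sum of the atom counts
  set F : Fin (r + 1) → Finset (Fin (r + 1) → Bool) := fun j => Finset.univ.filter fun w => w j = true with hF
  have hcount : ∀ (c : PointConfig E) (j : Fin (r + 1)), c.count (t j) = ∑ w ∈ F j, c.count (T w) := by
    intro c j
    rw [PointConfig.count_eq_sum_count_atom t c j]
    refine Finset.sum_congr rfl fun w hw => ?_
    rw [Finset.mem_filter] at hw
    rw [hTeq hw.2]
  -- the count vector `c ↦ (N_c(T w))_w`, its measurability, law and independence
  have hVm : Measurable fun (c : PointConfig E) (w : Fin (r + 1) → Bool) => c.count (T w) :=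
    measurable_pi_lambda _ fun w => PointConfig.measurable_count (hTm w)
  have hlaw : ∀ w, P.map (fun c : PointConfig E => c.count (T w)) =
      (poissonMeasure (ν (T w)).toNNReal).map ((↑) : ℕ → ℕ∞) := fun w => h.map_count (hTm w) (hTfin w)
  have hind : iIndepFun (fun w (c : PointConfig E) => c.count (T w)) P := by
    set eW := Fintype.equivFin (Fin (r + 1) → Bool) with heW
    have hfam := h.iIndepFun_count (s := fun i => T (eW.symm i)) (fun i => hTm _)
      (fun i j hij => hTdisj fun heq => hij (eW.symm.injective heq))
    have := hfam.precomp eW.injective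
    simpa using this
  -- the cylinder in terms of the count vector
  set 𝒜 : Set ((Fin (r + 1) → Bool) → ℕ∞) := {n | ∀ j : Fin r, ∑ w ∈ F j.succ, n w = k j} with h𝒜
  have h𝒜m : MeasurableSet 𝒜 := 𝒜.to_countable.measurableSet
  have hA : {c : PointConfig E | ∀ j, c.count (s j) = (k j : ℕ∞)} =
      (fun (c : PointConfig E) (w : Fin (r + 1) → Bool) => c.count (T w)) ⁻¹' 𝒜 := by
    ext c
    simp only [mem_setOf_eq, mem_preimage, h𝒜]
    refine forall_congr' fun j => ?_
    rw [← htsucc, hcount c j.succ]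
  set G : ((Fin (r + 1) → Bool) → ℕ∞) → ℝ≥0∞ := 𝒜.indicator 1 with hG
  have hupdm : ∀ w, Measurable fun c : PointConfig E =>
      Function.update (fun w' => c.count (T w')) w (c.count (T w) + 1) := fun w =>
    (measurable_of_countable fun n : (Fin (r + 1) → Bool) → ℕ∞ => Function.update n w (n w + 1)).comp hVm
  -- the left side
  have hLHS : ∫⁻ c in {c : PointConfig E | ∀ j, c.count (s j) = (k j : ℕ∞)}, ((c.count B : ℕ∞) : ℝ≥0∞) ∂P =
      ∑ w ∈ F 0, ν (T w) * P {c : PointConfig E |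
        Function.update (fun w' => c.count (T w')) w (c.count (T w) + 1) ∈ 𝒜} := by
    rw [hA, ← lintegral_indicator (hVm h𝒜m)]
    have h1 : ∀ c : PointConfig E,
        ((fun (c : PointConfig E) (w : Fin (r + 1) → Bool) => c.count (T w)) ⁻¹' 𝒜).indicator
          (fun c => ((c.count B : ℕ∞) : ℝ≥0∞)) c =
        ∑ w ∈ F 0, ((c.count (T w) : ℕ∞) : ℝ≥0∞) * G (fun w' => c.count (T w')) := by
      intro c
      rw [← Finset.sum_mul, ← toENNReal_finset_sum, ← hcount c 0, ht0, hG]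
      by_cases hc : (fun w' => c.count (T w')) ∈ 𝒜
      · rw [indicator_of_mem (show c ∈ (fun (c : PointConfig E) (w : Fin (r + 1) → Bool) => c.count (T w)) ⁻¹' 𝒜
          from hc), indicator_of_mem hc, Pi.one_apply, mul_one]
      · rw [indicator_of_notMem (show c ∉ (fun (c : PointConfig E) (w : Fin (r + 1) → Bool) => c.count (T w)) ⁻¹' 𝒜
          from hc), indicator_of_notMem hc, mul_zero]
    simp_rw [h1]
    rw [lintegral_finsetSum' _ fun w _ => ?_]
    swap
    · exact ((measurable_from_top.comp (PointConfig.measurable_count (hTm w))).mul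
        ((measurable_of_countable G).comp hVm)).aemeasurable
    refine Finset.sum_congr rfl fun w _ => ?_
    have key := lintegral_mul_eq_of_iIndepFun_poisson (fun w (c : PointConfig E) => c.count (T w))
      (fun w => PointConfig.measurable_count (hTm w)) (fun w => (ν (T w)).toNNReal) hlaw hind w G
    rw [key, ENNReal.coe_toNNReal (hTfin w)]
    congr 1
    rw [hG]
    set Sw : Set (PointConfig E) :=
      {c : PointConfig E | Function.update (fun w' => c.count (T w')) w (c.count (T w) + 1) ∈ 𝒜} with hSw
    have h2 : (fun c : PointConfig E => 𝒜.indicator (1 : ((Fin (r + 1) → Bool) → ℕ∞) → ℝ≥0∞)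
        (Function.update (fun w' => c.count (T w')) w (c.count (T w) + 1))) = Sw.indicator 1 := by
      funext c
      by_cases hc : Function.update (fun w' => c.count (T w')) w (c.count (T w) + 1) ∈ 𝒜
      · rw [indicator_of_mem hc, indicator_of_mem (show c ∈ Sw from hc)]; rfl
      · rw [indicator_of_notMem hc, indicator_of_notMem (show c ∉ Sw from hc)]
    rw [h2]
    exact lintegral_indicator_one ((hupdm w) h𝒜m)
  -- the right side
  have hRHS : ∫⁻ a in B, P {c : PointConfig E |
      ∀ j, (c ∪ PointConfig.ofFn (fun _ : Fin 1 => a)).count (s j) = (k j : ℕ∞)} ∂ν =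
      ∑ w ∈ F 0, ν (T w) * P {c : PointConfig E |
        Function.update (fun w' => c.count (T w')) w (c.count (T w) + 1) ∈ 𝒜} := by
    have hB' : B = ⋃ w ∈ F 0, T w := by
      have := PointConfig.eq_biUnion_atom t 0
      rw [ht0] at this
      rw [this]
      refine iUnion₂_congr fun w hw => ?_
      rw [Finset.mem_filter] at hw
      exact (hTeq hw.2).symm
    rw [hB', lintegral_biUnion_finset (fun w _ w' _ hne => hTdisj hne) (fun w _ => hTm w)]
    refine Finset.sum_congr rfl fun w hw => ?_
    rw [Finset.mem_filter] at hw
    have hconst : ∀ a ∈ T w, P {c : PointConfig E |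
        ∀ j, (c ∪ PointConfig.ofFn (fun _ : Fin 1 => a)).count (s j) = (k j : ℕ∞)} =
        P {c : PointConfig E | Function.update (fun w' => c.count (T w')) w (c.count (T w) + 1) ∈ 𝒜} := by
      intro a ha
      apply measure_congr
      have hnull := h.measure_setOf_mem_eq_zero (a := a) (measurableSet_singleton a)
      refine (measure_eq_zero_iff_ae_notMem.1 hnull).mono fun c hac => ?_
      simp only [mem_setOf_eq] at hac
      -- counts of the atoms after inserting `a ∉ c`, `a ∈ T w`
      have hterm : ∀ w', (c ∪ PointConfig.ofFn (fun _ : Fin 1 => a)).count (T w') =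
          Function.update (fun w' => c.count (T w')) w (c.count (T w) + 1) w' := by
        intro w'
        rw [PointConfig.count_union_ofFn_one, Function.update_apply]
        by_cases hw' : w' = w
        · subst hw'
          rw [if_pos ⟨ha, hac⟩, if_pos rfl]
        · rw [if_neg (fun h' => hw' ?_), if_neg hw', add_zero]
          by_contra hne
          exact Set.disjoint_left.1 (hTdisj hne) h'.1 ha
      change (∀ j, (c ∪ PointConfig.ofFn (fun _ : Fin 1 => a)).count (s j) = (k j : ℕ∞)) =
        (Function.update (fun w' => c.count (T w')) w (c.count (T w) + 1) ∈ 𝒜)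
      simp only [h𝒜, mem_setOf_eq]
      refine propext (forall_congr' fun j => ?_)
      rw [← htsucc, hcount _ j.succ]
      simp_rw [hterm]
    rw [setLIntegral_congr_fun (hTm w) hconst, setLIntegral_const, mul_comm]
  exact hLHS.trans hRHS.symm

/-! ## The Campbell measure is the insertion measure -/

/-- **The Campbell measure is the insertion measure.** For a Poisson process with σ-finite
intensity and an s-finite kernel `κ` with `κ c = ∑_{a ∈ c} δ_a` whenever the counts of `c` on the
spanning sets are finite (a.s.), the Campbell measure `P ⊗ₘ κ` on `PointConfig E × E` equals the
image of `ν ⊗ P` under `(a, c) ↦ (c ∪ {a}, a)`: both agree on products of count cylinders with sets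
of finite intensity (`setLIntegral_count_eq_setLIntegral_measure_insert`), a generating π-system
(`generateFrom_countCylinders`, `generateFrom_finiteMeasure_eq`, `generateFrom_prod_eq`) with an
exhaustion of finite Campbell mass `𝔼 N(S_n) = ν(S_n)` (`lintegral_count`). This is the
measure form of the Mecke equation (Last–Penrose 2017 Thm 4.1). [cite: LastPenrose2017, Thm 4.1] -/
theorem compProd_eq_map_insert [SigmaFinite ν] (h : IsPoissonPointProcess ν P)
    (κ : Kernel (PointConfig E) E) [IsSFiniteKernel κ]
    (hκ : ∀ c : PointConfig E, (∀ n, c.count (spanningSets ν n) < ⊤) → κ c = c.toMeasure) :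
    P ⊗ₘ κ = (ν.prod P).map
      (fun p : E × PointConfig E => (p.2 ∪ PointConfig.ofFn (fun _ : Fin 1 => p.1), p.1)) := by
  classical
  haveI := h.isProbabilityMeasure
  set C := {A : Set (PointConfig E) | ∃ (r : ℕ) (s : Fin r → Set E) (k : Fin r → ℕ),
      (∀ j, MeasurableSet (s j) ∧ ν (s j) ≠ ∞) ∧ A = {c | ∀ j, c.count (s j) = (k j : ℕ∞)}} with hC
  set D := {B : Set E | MeasurableSet B ∧ ν B ≠ ∞} with hD
  have hι : Measurable (fun p : E × PointConfig E =>
      (p.2 ∪ PointConfig.ofFn (fun _ : Fin 1 => p.1), p.1)) :=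
    PointConfig.measurable_union_ofFn_one.prodMk measurable_fst
  have hG : ∀ᵐ c ∂P, ∀ n, c.count (spanningSets ν n) < ⊤ :=
    ae_all_iff.2 fun n => h.count_ae_lt_top (measurableSet_spanningSets ν n)
      (measure_spanningSets_lt_top ν n).ne
  have hκae : ∀ {B : Set E}, MeasurableSet B → ∀ᵐ c ∂P, κ c B = ((c.count B : ℕ∞) : ℝ≥0∞) :=
    fun hB => hG.mono fun c hc => by rw [hκ c hc, PointConfig.toMeasure_apply' _ hB]
  refine Measure.ext_of_generateFrom_of_iUnion (image2 (· ×ˢ ·) C D)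
    (fun n => (univ : Set (PointConfig E)) ×ˢ spanningSets ν n) ?_ ?_ ?_ ?_ ?_ ?_
  · have := generateFrom_prod_eq (α := PointConfig E) (β := E)
      (PointConfig.isCountablySpanning_countCylinders ν) (PointConfig.isCountablySpanning_finiteMeasure ν)
    rw [PointConfig.generateFrom_countCylinders ν, PointConfig.generateFrom_finiteMeasure_eq ν] at this
    exact this
  · exact (PointConfig.isPiSystem_countCylinders ν).prod fun B₁ h₁ B₂ h₂ _ =>
      ⟨h₁.1.inter h₂.1, ne_top_of_le_ne_top h₁.2 (measure_mono inter_subset_left)⟩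
  · rw [← prod_iUnion, iUnion_spanningSets, univ_prod_univ]
  · exact fun n => mem_image2_of_mem (PointConfig.univ_mem_countCylinders ν)
      ⟨measurableSet_spanningSets ν n, (measure_spanningSets_lt_top ν n).ne⟩
  · intro n
    rw [Measure.compProd_apply_prod MeasurableSet.univ (measurableSet_spanningSets ν n),
      Measure.restrict_univ, lintegral_congr_ae (hκae (measurableSet_spanningSets ν n)),
      h.lintegral_count (measurableSet_spanningSets ν n) (measure_spanningSets_lt_top ν n).ne]
    exact (measure_spanningSets_lt_top ν n).ne
  · rintro _ ⟨A, ⟨r, s, k, hs, rfl⟩, B, ⟨hB, hBfin⟩, rfl⟩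
    have hAm : MeasurableSet {c : PointConfig E | ∀ j, c.count (s j) = (k j : ℕ∞)} :=
      PointConfig.measurableSet_setOf_count_eq (fun j => (hs j).1) k
    dsimp only
    rw [Measure.compProd_apply_prod hAm hB, Measure.map_apply hι (hAm.prod hB),
      lintegral_congr_ae (ae_restrict_of_ae (hκae hB)), Measure.prod_apply (hι (hAm.prod hB))]
    have hsec : ∀ a : E, P (Prod.mk a ⁻¹' ((fun p : E × PointConfig E =>
        (p.2 ∪ PointConfig.ofFn (fun _ : Fin 1 => p.1), p.1)) ⁻¹'
        ({c : PointConfig E | ∀ j, c.count (s j) = (k j : ℕ∞)} ×ˢ B))) =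
        B.indicator (fun a => P {c : PointConfig E |
          ∀ j, (c ∪ PointConfig.ofFn (fun _ : Fin 1 => a)).count (s j) = (k j : ℕ∞)}) a := by
      intro a
      by_cases ha : a ∈ B
      · rw [indicator_of_mem ha]
        congr 1
        ext c
        simp [ha]
      · rw [indicator_of_notMem ha]
        convert measure_empty (μ := P)
        ext c
        simp [ha]
    simp_rw [hsec]
    rw [lintegral_indicator hB]
    exact h.setLIntegral_count_eq_setLIntegral_measure_insert hs k hB hBfin

/-! ## The univariate Mecke equation -/

/-- **The Mecke equation, kernel form**: `∫ ∫ f(c, a) c(da) P(dc) = ∫ ∫ f(c ∪ {a}, a) P(dc) ν(da)`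
for measurable `f ≥ 0` (Last–Penrose 2017 Thm 4.1, (4.2): `η(dx)` integration on the left,
`η + δ_x` on the right), by integrating `f` against the two equal measures of
`compProd_eq_map_insert`. [cite: LastPenrose2017, Thm 4.1] -/
theorem lintegral_lintegral_toMeasure_eq [SigmaFinite ν] (h : IsPoissonPointProcess ν P)
    {f : PointConfig E × E → ℝ≥0∞} (hf : Measurable f) :
    ∫⁻ c, ∫⁻ a, f (c, a) ∂c.toMeasure ∂P =
      ∫⁻ a, ∫⁻ c, f (c ∪ PointConfig.ofFn (fun _ : Fin 1 => a), a) ∂P ∂ν := by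
  haveI := h.isProbabilityMeasure
  obtain ⟨κ, hκs, hκ, -⟩ := PointConfig.exists_sFiniteKernel (E := E) (spanningSets ν)
    (measurableSet_spanningSets ν) (iUnion_spanningSets ν)
  haveI := hκs
  have hG : ∀ᵐ c ∂P, ∀ n, c.count (spanningSets ν n) < ⊤ :=
    ae_all_iff.2 fun n => h.count_ae_lt_top (measurableSet_spanningSets ν n)
      (measure_spanningSets_lt_top ν n).ne
  have hι : Measurable (fun p : E × PointConfig E =>
      (p.2 ∪ PointConfig.ofFn (fun _ : Fin 1 => p.1), p.1)) :=
    PointConfig.measurable_union_ofFn_one.prodMk measurable_fst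
  calc ∫⁻ c, ∫⁻ a, f (c, a) ∂c.toMeasure ∂P
      = ∫⁻ c, ∫⁻ a, f (c, a) ∂(κ c) ∂P :=
        lintegral_congr_ae (hG.mono fun c hc => by
          change ∫⁻ a, f (c, a) ∂c.toMeasure = ∫⁻ a, f (c, a) ∂(κ c)
          rw [hκ c hc])
    _ = ∫⁻ p, f p ∂(P ⊗ₘ κ) := (Measure.lintegral_compProd hf).symm
    _ = ∫⁻ p, f p ∂((ν.prod P).map fun p : E × PointConfig E =>
          (p.2 ∪ PointConfig.ofFn (fun _ : Fin 1 => p.1), p.1)) := by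
        rw [h.compProd_eq_map_insert κ hκ]
    _ = ∫⁻ q, f (q.2 ∪ PointConfig.ofFn (fun _ : Fin 1 => q.1), q.1) ∂(ν.prod P) := lintegral_map hf hι
    _ = ∫⁻ a, ∫⁻ c, f (c ∪ PointConfig.ofFn (fun _ : Fin 1 => a), a) ∂P ∂ν :=
        lintegral_prod _ (hf.comp hι).aemeasurable

/-- **The Mecke equation** (Last–Penrose 2017 Thm 4.1, (4.2)) for a Poisson process given by
Kingman's axioms on a second countable Hausdorff Borel space with σ-finite intensity:
`𝔼 ∑_{a ∈ c} f(c, a) = ∫ 𝔼 f(c ∪ {a}, a) ν(da)` for every measurable `f ≥ 0` (the sum over the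
points of `c` is a.s. the integral against `c.toMeasure`, configurations being a.s. countable).
[cite: LastPenrose2017, Thm 4.1] -/
theorem lintegral_tsum_eq_lintegral_lintegral_insert [SigmaFinite ν] (h : IsPoissonPointProcess ν P)
    {f : PointConfig E × E → ℝ≥0∞} (hf : Measurable f) :
    ∫⁻ c, ∑' a : (c : Set E), f (c, a) ∂P =
      ∫⁻ a, ∫⁻ c, f (c ∪ PointConfig.ofFn (fun _ : Fin 1 => a), a) ∂P ∂ν := by
  rw [← h.lintegral_lintegral_toMeasure_eq hf]
  have hG : ∀ᵐ c ∂P, ∀ n, c.count (spanningSets ν n) < ⊤ :=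
    ae_all_iff.2 fun n => h.count_ae_lt_top (measurableSet_spanningSets ν n)
      (measure_spanningSets_lt_top ν n).ne
  refine lintegral_congr_ae (hG.mono fun c hc => ?_)
  change (∑' a : (c : Set E), f (c, a)) = ∫⁻ a, f (c, a) ∂c.toMeasure
  exact (PointConfig.lintegral_toMeasure' c (c.countable_of_count_lt_top (iUnion_spanningSets ν) hc)
    (fun a => f (c, a))).symm

/-! ## Sums over injective tuples: splitting off the first point, measurable versions -/

omit [T2Space E] [SecondCountableTopology E] [MeasurableSpace E] [BorelSpace E] in
open Classical in
/-- **Splitting off the first point**: a sum over injective `(m+1)`-tuples of points of `c` is the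
sum over the first point `b ∈ c` of the sums over injective `m`-tuples of points of `c` avoiding
`b`, of the tuple `b :: y` (`ℝ≥0∞`-valued, unconditional sums; via `Fin.consEquiv` and indicator
bookkeeping). [folklore] -/
theorem tsum_injective_succ (c : PointConfig E) {m : ℕ} (g : (Fin (m + 1) → E) → ℝ≥0∞) :
    ∑' x : {x : Fin (m + 1) → E // Function.Injective x ∧ ∀ i, x i ∈ c}, g x.1 =
      ∑' b : (c : Set E), ∑' y : {y : Fin m → E // Function.Injective y ∧ ∀ i, y i ∈ c},
        (if ∀ i, y.1 i ≠ b then g (Fin.cons (b : E) y.1) else 0) := by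
  classical
  set A : Set (Fin (m + 1) → E) := {x | Function.Injective x ∧ ∀ i, x i ∈ c} with hA
  set B : Set (Fin m → E) := {y | Function.Injective y ∧ ∀ i, y i ∈ c} with hB
  have hpt : ∀ (b : E) (y : Fin m → E), A.indicator g (Fin.cons b y) =
      (c : Set E).indicator (fun b => B.indicator
        (fun y => if ∀ i, y i ≠ b then g (Fin.cons b y) else 0) y) b := by
    intro b y
    by_cases hb : b ∈ (c : Set E)
    · rw [indicator_of_mem hb]
      by_cases hy : y ∈ B
      · rw [indicator_of_mem hy]
        by_cases hyb : ∀ i, y i ≠ b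
        · rw [if_pos hyb, indicator_of_mem]
          refine ⟨Fin.cons_injective_iff.2 ⟨?_, hy.1⟩, Fin.cases hb hy.2⟩
          rintro ⟨i, hi⟩
          exact hyb i hi
        · rw [if_neg hyb, indicator_of_notMem]
          rintro ⟨hinj, -⟩
          rw [Fin.cons_injective_iff] at hinj
          push Not at hyb
          obtain ⟨i, hi⟩ := hyb
          exact hinj.1 ⟨i, hi⟩
      · rw [indicator_of_notMem hy, indicator_of_notMem]
        rintro ⟨hinj, hmem⟩
        rw [Fin.cons_injective_iff] at hinj
        exact hy ⟨hinj.2, fun i => by simpa using hmem i.succ⟩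
    · rw [indicator_of_notMem hb, indicator_of_notMem]
      rintro ⟨-, hmem⟩
      exact hb (by simpa using hmem 0)
  calc ∑' x : A, g x.1 = ∑' x, A.indicator g x := tsum_subtype A g
    _ = ∑' p : E × (Fin m → E), A.indicator g (Fin.cons p.1 p.2) := by
        rw [← (Fin.consEquiv fun _ : Fin (m + 1) => E).tsum_eq]
        rfl
    _ = ∑' (b : E) (y : Fin m → E), A.indicator g (Fin.cons b y) := ENNReal.tsum_prod'
    _ = ∑' b : E, (c : Set E).indicator (fun b => ∑' y : Fin m → E, B.indicator
          (fun y => if ∀ i, y i ≠ b then g (Fin.cons b y) else 0) y) b := by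
        refine tsum_congr fun b => ?_
        by_cases hb : b ∈ (c : Set E)
        · simp_rw [hpt, indicator_of_mem hb]
        · simp_rw [hpt, indicator_of_notMem hb, tsum_zero]
    _ = ∑' b : (c : Set E), ∑' y : B, (if ∀ i, y.1 i ≠ b then g (Fin.cons (b : E) y.1) else 0) := by
        rw [tsum_subtype (c : Set E) (fun b => ∑' y : B, if ∀ i, y.1 i ≠ b then g (Fin.cons b y.1) else 0)]
        refine tsum_congr fun b => ?_
        congr 1
        funext b'
        exact (tsum_subtype B fun y => if ∀ i, y i ≠ b' then g (Fin.cons b' y) else 0).symm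

omit [T2Space E] [SecondCountableTopology E] [MeasurableSpace E] [BorelSpace E] in
open Classical in
/-- After inserting a point `b ∉ c`, the injective `m`-tuples of points of `c ∪ {b}` avoiding `b`
are exactly the injective `m`-tuples of points of `c`. [folklore] -/
theorem tsum_injective_union_single {c : PointConfig E} {b : E} (hb : b ∉ c) {m : ℕ}
    (g : (Fin m → E) → ℝ≥0∞) :
    ∑' y : {y : Fin m → E // Function.Injective y ∧
        ∀ i, y i ∈ c ∪ PointConfig.ofFn (fun _ : Fin 1 => b)},
        (if ∀ i, y.1 i ≠ b then g y.1 else 0) =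
      ∑' y : {y : Fin m → E // Function.Injective y ∧ ∀ i, y i ∈ c}, g y.1 := by
  classical
  change (∑' y : ↥{y : Fin m → E | Function.Injective y ∧ ∀ i, y i ∈ c ∪ PointConfig.ofFn (fun _ : Fin 1 => b)},
      (if ∀ i, y.1 i ≠ b then g y.1 else 0)) =
    ∑' y : ↥{y : Fin m → E | Function.Injective y ∧ ∀ i, y i ∈ c}, g y.1
  rw [tsum_subtype {y : Fin m → E | Function.Injective y ∧ ∀ i, y i ∈ c ∪ PointConfig.ofFn (fun _ : Fin 1 => b)}
      (fun y => if ∀ i, y i ≠ b then g y else 0),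
    tsum_subtype {y : Fin m → E | Function.Injective y ∧ ∀ i, y i ∈ c} g]
  refine tsum_congr fun y => ?_
  by_cases hy : y ∈ {y : Fin m → E | Function.Injective y ∧ ∀ i, y i ∈ c}
  · have hyb : ∀ i, y i ≠ b := fun i hi => hb (hi ▸ hy.2 i)
    rw [indicator_of_mem hy, indicator_of_mem, if_pos hyb]
    exact ⟨hy.1, fun i => (PointConfig.mem_union).2 (Or.inl (hy.2 i))⟩
  · rw [indicator_of_notMem hy]
    by_cases hy' : y ∈ {y : Fin m → E | Function.Injective y ∧ ∀ i, y i ∈ c ∪ PointConfig.ofFn (fun _ : Fin 1 => b)}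
    · rw [indicator_of_mem hy', if_neg]
      intro hyb
      refine hy ⟨hy'.1, fun i => ?_⟩
      rcases (PointConfig.mem_union).1 (hy'.2 i) with h | h
      · exact h
      · obtain ⟨_, h⟩ := (PointConfig.mem_ofFn).1 h
        exact absurd h.symm (hyb i)
    · rw [indicator_of_notMem hy']

open Classical in
/-- **Measurable versions of sums over injective tuples.** Given an s-finite kernel `κ` with
`κ c = ∑_{a ∈ c} δ_a` on a set `G` of countable configurations, every parametrised sum
`(a, c) ↦ ∑_{y ∈ cᵐ injective} F(a, y, c)` of a measurable `F ≥ 0` agrees on `G` with a measurable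
function of `(a, c)` (induction on `m`: split off the first point, `tsum_injective_succ`, and
integrate the measurable version of the rest against `κ`; kernel integrals are measurable). This
replaces the factorial measures `η^{(m)}` of Last–Penrose (4.9) for laws given on the count
σ-algebra only. [folklore] -/
theorem exists_measurable_tsum_injective (κ : Kernel (PointConfig E) E) [IsSFiniteKernel κ]
    (G : Set (PointConfig E)) (hκ : ∀ c ∈ G, κ c = c.toMeasure) (hGc : ∀ c ∈ G, (c : Set E).Countable)
    (m : ℕ) {α : Type u} [MeasurableSpace α] (F : α × (Fin m → E) × PointConfig E → ℝ≥0∞)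
    (hF : Measurable F) :
    ∃ Φ : α × PointConfig E → ℝ≥0∞, Measurable Φ ∧ ∀ a, ∀ c ∈ G,
      Φ (a, c) = ∑' y : {y : Fin m → E // Function.Injective y ∧ ∀ i, y i ∈ c}, F (a, y.1, c) := by
  classical
  induction m generalizing α with
  | zero =>
    refine ⟨fun p => F (p.1, Fin.elim0, p.2), hF.comp (measurable_fst.prodMk (measurable_const.prodMk
      measurable_snd)), fun a c _ => ?_⟩
    have y₀ : {y : Fin 0 → E // Function.Injective y ∧ ∀ i, y i ∈ c} :=
      ⟨Fin.elim0, Function.injective_of_subsingleton _, fun i => i.elim0⟩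
    rw [tsum_eq_single y₀ fun y hy => absurd (Subtype.ext (Subsingleton.elim _ _)) hy]
    change F (a, Fin.elim0, c) = F (a, y₀.1, c)
    congr 1
    exact Prod.ext rfl (Prod.ext (Subsingleton.elim (α := Fin 0 → E) _ _) rfl)
  | succ m ih =>
    -- the functional with the first point split off
    set F' : (α × E) × (Fin m → E) × PointConfig E → ℝ≥0∞ := fun p =>
      if ∀ i, p.2.1 i ≠ p.1.2 then F (p.1.1, Fin.cons p.1.2 p.2.1, p.2.2) else 0 with hF'
    have hF'm : Measurable F' := by
      refine Measurable.ite ?_ (hF.comp (measurable_fst.fst.prodMk ((measurable_pi_lambda _ fun i => ?_).prodMk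
        measurable_snd.snd))) measurable_const
      · have : {p : (α × E) × (Fin m → E) × PointConfig E | ∀ i, p.2.1 i ≠ p.1.2} =
            ⋂ i, {p | (p.2.1 i, p.1.2) ∉ Set.diagonal E} := by
          ext p; simp [Set.mem_diagonal_iff]
        rw [this]
        exact MeasurableSet.iInter fun i => ((isClosed_diagonal (X := E)).measurableSet.preimage
          (((measurable_pi_apply i).comp measurable_snd.fst).prodMk measurable_fst.snd)).compl
      · refine Fin.cases ?_ (fun j => ?_) i
        · simp only [Fin.cons_zero]
          exact measurable_fst.snd
        · simp only [Fin.cons_succ]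
          exact (measurable_pi_apply j).comp measurable_snd.fst
    obtain ⟨Φ', hΦ'm, hΦ'⟩ := ih F' hF'm
    refine ⟨fun p => ∫⁻ b, Φ' ((p.1, b), p.2) ∂(κ p.2), ?_, fun a c hc => ?_⟩
    · have hker : Measurable fun p : α × PointConfig E => ∫⁻ b, Φ' ((p.1, b), p.2) ∂(Kernel.prodMkLeft α κ p) :=
        (hΦ'm.comp ((measurable_fst.fst.prodMk measurable_snd).prodMk measurable_fst.snd)).lintegral_kernel_prod_right'
      simpa [Kernel.prodMkLeft_apply] using hker
    · dsimp only
      rw [hκ c hc, PointConfig.lintegral_toMeasure' c (hGc c hc), tsum_injective_succ c (fun x => F (a, x, c))]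
      refine tsum_congr fun b => ?_
      rw [hΦ' (a, (b : E)) c hc]

/-! ## The product measure on `Fin (m+1) → E` splits off the first coordinate -/

omit [TopologicalSpace E] [T2Space E] [SecondCountableTopology E] [BorelSpace E] in
/-- Integration against `ν^{⊗(m+1)}` on `Fin (m+1) → E` is integration in the first coordinate and
then against `ν^{⊗m}` of `b :: y` (`measurePreserving_piFinSuccAbove` at `0`, Tonelli). [folklore] -/
theorem lintegral_pi_succ_eq_lintegral_lintegral_cons (ν : Measure E) [SigmaFinite ν] (m : ℕ)
    {g : (Fin (m + 1) → E) → ℝ≥0∞} (hg : Measurable g) :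
    ∫⁻ x, g x ∂(Measure.pi fun _ : Fin (m + 1) => ν) =
      ∫⁻ b, ∫⁻ y, g (Fin.cons b y) ∂(Measure.pi fun _ : Fin m => ν) ∂ν := by
  have hmp := MeasurePreserving.symm _ (measurePreserving_piFinSuccAbove (fun _ : Fin (m + 1) => ν) 0)
  rw [← hmp.lintegral_comp hg,
    lintegral_prod (fun p : E × (Fin m → E) => g ((MeasurableEquiv.piFinSuccAbove (fun _ => E) 0).symm p))
      (hg.comp hmp.measurable).aemeasurable]
  refine lintegral_congr fun b => lintegral_congr fun y => ?_
  rw [MeasurableEquiv.piFinSuccAbove_symm_apply]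
  simp [Fin.insertNthEquiv, Fin.insertNth_zero']

/-! ## The multivariate Mecke equation -/

open Classical in
/-- **The multivariate Mecke equation** (Last–Penrose 2017 Thm 4.4, (4.11)) from Kingman's axioms:
for every `m` and measurable `h ≥ 0` on `(Fin m → E) × PointConfig E`,
`𝔼 ∑_{x ∈ cᵐ injective} h(x, c) = ∫ 𝔼 h(x, c ∪ {x₁, …, x_m}) ν^{⊗m}(dx)`.
Induction on `m` as in the printed proof: split off the first point (`tsum_injective_succ`), pass
to a measurable version of the inner sum (`exists_measurable_tsum_injective`), apply the Mecke
equation (`lintegral_tsum_eq_lintegral_lintegral_insert`), remove the void constraint after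
inserting `b ∉ c` a.s. (`tsum_injective_union_single`, `measure_setOf_mem_eq_zero`), apply the
induction hypothesis to `(y, c) ↦ h(b :: y, c ∪ {b})`, and reassemble `ν ⊗ ν^{⊗m} = ν^{⊗(m+1)}`
(`lintegral_pi_succ_eq_lintegral_lintegral_cons`, `union_ofFn_cons`). [cite: LastPenrose2017, Thm 4.4] -/
theorem lintegral_tsum_injective_eq [SigmaFinite ν] (h : IsPoissonPointProcess ν P) (m : ℕ)
    (H : (Fin m → E) × PointConfig E → ℝ≥0∞) (hH : Measurable H) :
    ∫⁻ c, (∑' x : {x : Fin m → E // Function.Injective x ∧ ∀ i, x i ∈ c}, H (x.1, c)) ∂P =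
      ∫⁻ x, ∫⁻ c, H (x, c ∪ PointConfig.ofFn x) ∂P ∂(Measure.pi fun _ : Fin m => ν) := by
  classical
  haveI := h.isProbabilityMeasure
  obtain ⟨κ, hκs, hκ, -⟩ := PointConfig.exists_sFiniteKernel (E := E) (spanningSets ν)
    (measurableSet_spanningSets ν) (iUnion_spanningSets ν)
  haveI := hκs
  set G : Set (PointConfig E) := {c | ∀ n, c.count (spanningSets ν n) < ⊤} with hGdef
  have hG : ∀ᵐ c ∂P, c ∈ G :=
    ae_all_iff.2 fun n => h.count_ae_lt_top (measurableSet_spanningSets ν n)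
      (measure_spanningSets_lt_top ν n).ne
  have hGc : ∀ c ∈ G, (c : Set E).Countable := fun c hc =>
    c.countable_of_count_lt_top (iUnion_spanningSets ν) hc
  have hGins : ∀ c ∈ G, ∀ b : E, c ∪ PointConfig.ofFn (fun _ : Fin 1 => b) ∈ G := by
    intro c hc b n
    change (c ∪ PointConfig.ofFn (fun _ : Fin 1 => b)).count (spanningSets ν n) < ⊤
    rw [PointConfig.count_union_ofFn_one]
    refine WithTop.add_lt_top.2 ⟨hc n, ?_⟩
    split_ifs
    · exact ENat.coe_lt_top 1
    · exact ENat.coe_lt_top 0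
  induction m with
  | zero =>
    have hpt : ∀ c : PointConfig E,
        (∑' x : {x : Fin 0 → E // Function.Injective x ∧ ∀ i, x i ∈ c}, H (x.1, c)) = H (Fin.elim0, c) := by
      intro c
      have y₀ : {x : Fin 0 → E // Function.Injective x ∧ ∀ i, x i ∈ c} :=
        ⟨Fin.elim0, Function.injective_of_subsingleton _, fun i => i.elim0⟩
      rw [tsum_eq_single y₀ fun y hy => absurd (Subtype.ext (Subsingleton.elim _ _)) hy]
      congr 2
      exact Subsingleton.elim _ _
    simp_rw [hpt]
    have hmeas : Measurable fun x : Fin 0 → E => ∫⁻ c, H (x, c ∪ PointConfig.ofFn x) ∂P :=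
      (hH.comp (measurable_fst.prodMk (PointConfig.measurable_union_ofFn 0))).lintegral_prod_right'
    rw [Measure.pi_of_empty (fun _ : Fin 0 => ν), lintegral_dirac' _ hmeas]
    simp_rw [PointConfig.union_ofFn_zero]
    congr 1
  | succ m ih =>
    -- Step 1: split off the first point and pass to a measurable version of the inner sum
    set F₁ : E × (Fin m → E) × PointConfig E → ℝ≥0∞ := fun p =>
      if ∀ i, p.2.1 i ≠ p.1 then H (Fin.cons p.1 p.2.1, p.2.2) else 0 with hF₁
    have hF₁m : Measurable F₁ := by
      refine Measurable.ite ?_ (hH.comp ((measurable_pi_lambda _ fun i => ?_).prodMk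
        measurable_snd.snd)) measurable_const
      · have : {p : E × (Fin m → E) × PointConfig E | ∀ i, p.2.1 i ≠ p.1} =
            ⋂ i, {p | (p.2.1 i, p.1) ∉ Set.diagonal E} := by
          ext p; simp [Set.mem_diagonal_iff]
        rw [this]
        exact MeasurableSet.iInter fun i => ((isClosed_diagonal (X := E)).measurableSet.preimage
          (((measurable_pi_apply i).comp measurable_snd.fst).prodMk measurable_fst)).compl
      · refine Fin.cases ?_ (fun j => ?_) i
        · simp only [Fin.cons_zero]
          exact measurable_fst
        · simp only [Fin.cons_succ]
          exact (measurable_pi_apply j).comp measurable_snd.fst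
    obtain ⟨Φ, hΦm, hΦ⟩ := exists_measurable_tsum_injective κ G hκ hGc m F₁ hF₁m
    have h1 : ∀ c ∈ G, (∑' x : {x : Fin (m + 1) → E // Function.Injective x ∧ ∀ i, x i ∈ c}, H (x.1, c)) =
        ∑' b : (c : Set E), Φ (b, c) := fun c hc => by
      rw [tsum_injective_succ c (fun x => H (x, c))]
      exact tsum_congr fun b => (hΦ (b : E) c hc).symm
    -- Step 2: the univariate Mecke equation for `(c, b) ↦ Φ (b, c)`
    have h2 := h.lintegral_tsum_eq_lintegral_lintegral_insert (f := fun p : PointConfig E × E => Φ (p.2, p.1))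
      (hΦm.comp (measurable_snd.prodMk measurable_fst))
    -- Step 3: after inserting `b ∉ c`, the inner sum is over tuples of points of `c`
    have h3 : ∀ b : E, ∀ᵐ c ∂P, Φ (b, c ∪ PointConfig.ofFn (fun _ : Fin 1 => b)) =
        ∑' y : {y : Fin m → E // Function.Injective y ∧ ∀ i, y i ∈ c},
          H (Fin.cons b y.1, c ∪ PointConfig.ofFn (fun _ : Fin 1 => b)) := by
      intro b
      filter_upwards [hG, measure_eq_zero_iff_ae_notMem.1
        (h.measure_setOf_mem_eq_zero (a := b) (measurableSet_singleton b))] with c hc hbc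
      rw [hΦ b _ (hGins c hc b)]
      exact tsum_injective_union_single hbc
        (fun y => H (Fin.cons b y, c ∪ PointConfig.ofFn (fun _ : Fin 1 => b)))
    -- Step 4: the induction hypothesis for `(y, c) ↦ H (b :: y, c ∪ {b})`
    have h4 : ∀ b : E, ∫⁻ c, (∑' y : {y : Fin m → E // Function.Injective y ∧ ∀ i, y i ∈ c},
        H (Fin.cons b y.1, c ∪ PointConfig.ofFn (fun _ : Fin 1 => b))) ∂P =
        ∫⁻ y, ∫⁻ c, H (Fin.cons b y, (c ∪ PointConfig.ofFn y) ∪ PointConfig.ofFn (fun _ : Fin 1 => b)) ∂P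
          ∂(Measure.pi fun _ : Fin m => ν) := fun b => by
      refine ih (fun p => H (Fin.cons b p.1, p.2 ∪ PointConfig.ofFn (fun _ : Fin 1 => b))) ?_
      refine hH.comp ((measurable_pi_lambda _ fun i => ?_).prodMk
        (PointConfig.measurable_union_ofFn_one.comp (measurable_const.prodMk measurable_snd)))
      refine Fin.cases ?_ (fun j => ?_) i
      · simp only [Fin.cons_zero]
        exact measurable_const
      · simp only [Fin.cons_succ]
        exact (measurable_pi_apply j).comp measurable_fst
    -- Step 5: the measurable integrand in `x = b :: y`
    have hmeas : Measurable fun x : Fin (m + 1) → E => ∫⁻ c, H (x, c ∪ PointConfig.ofFn x) ∂P :=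
      (hH.comp (measurable_fst.prodMk (PointConfig.measurable_union_ofFn (m + 1)))).lintegral_prod_right'
    calc ∫⁻ c, (∑' x : {x : Fin (m + 1) → E // Function.Injective x ∧ ∀ i, x i ∈ c}, H (x.1, c)) ∂P
        = ∫⁻ c, ∑' b : (c : Set E), Φ (b, c) ∂P := lintegral_congr_ae (hG.mono fun c hc => h1 c hc)
      _ = ∫⁻ b, ∫⁻ c, Φ (b, c ∪ PointConfig.ofFn (fun _ : Fin 1 => b)) ∂P ∂ν := h2
      _ = ∫⁻ b, ∫⁻ c, (∑' y : {y : Fin m → E // Function.Injective y ∧ ∀ i, y i ∈ c},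
            H (Fin.cons b y.1, c ∪ PointConfig.ofFn (fun _ : Fin 1 => b))) ∂P ∂ν :=
          lintegral_congr fun b => lintegral_congr_ae (h3 b)
      _ = ∫⁻ b, ∫⁻ y, ∫⁻ c, H (Fin.cons b y, (c ∪ PointConfig.ofFn y) ∪ PointConfig.ofFn (fun _ : Fin 1 => b)) ∂P
            ∂(Measure.pi fun _ : Fin m => ν) ∂ν := lintegral_congr fun b => h4 b
      _ = ∫⁻ b, ∫⁻ y, ∫⁻ c, H (Fin.cons b y, c ∪ PointConfig.ofFn (Fin.cons b y : Fin (m + 1) → E)) ∂P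
            ∂(Measure.pi fun _ : Fin m => ν) ∂ν := by
          simp_rw [PointConfig.union_ofFn_cons]
      _ = ∫⁻ x, ∫⁻ c, H (x, c ∪ PointConfig.ofFn x) ∂P ∂(Measure.pi fun _ : Fin (m + 1) => ν) :=
          (lintegral_pi_succ_eq_lintegral_lintegral_cons ν m hmeas).symm

end IsPoissonPointProcess

/-- **Discharge of the named fact `IsPoissonPointProcess.multivariateMecke`** (Last–Penrose 2017
Thm 4.4): the multivariate Mecke equation holds for every Poisson point process given by
Kingman's axioms on a second countable Hausdorff Borel space with σ-finite intensity
(`IsPoissonPointProcess.lintegral_tsum_injective_eq`). [cite: LastPenrose2017, Thm 4.4] -/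
theorem IsPoissonPointProcess.multivariateMecke_holds : IsPoissonPointProcess.multivariateMecke :=
  fun h m H hH => h.lintegral_tsum_injective_eq m H hH

end Literature.Analysis.FunctionSpaces
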